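import Summits.NavierStokesRegularity.TurbBounds.ShearTailRule
import Summits.NavierStokesRegularity.TurbBounds.Certs.C200.Scalars

/-!
# Certificate C200 (CERTIFIED.md row R-C200 = gate G1: plane Couette, Re 200, Γ_y = 2π) — the recorded tail slacks ARE the rule's values

`Certs.C200.Scalars.tailW` / `tailT` (22 + 22 literals copied from the container, with `tailW_nonneg` / `tailT_nonneg`) equal, in the kernel, the lists
produced by the two-field tail-slack RULE of rbsdp SPEC 3.4–3.7 under the Couette symbol map (`ShearTailRule.tailWList` / `tailTList`) at the row's data:
c = `Scalars.c` (= a − 1), T = ‖ĝ‖₁ = `Scalars.T`, P = 12, N_m = `Scalars.Nm`, ε_m = `Scalars.eps`. Hence both tail-lemma hypotheses of every certified mode hold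
for the RULE's values, not merely for recorded literals. Pure theorem file (pub-turb-shear gen 5).
HONEST FRAMING: rigorous bounds for the stated PDE and boundary conditions; no claim about physical turbulence beyond the bound.
-/

namespace Summit.NavierStokesRegularity.TurbBounds.Certs.C200

/-- **R-C200: recorded W-tail slacks = rule values** (modes 1 … 22; P = 12). -/
theorem tailW_rule : Scalars.tailW = ShearTailRule.tailWList Scalars.c Scalars.T 12 Scalars.Nm Scalars.eps := by
  decide +kernel

/-- **R-C200: recorded Θ-tail slacks = rule values** (modes 1 … 22; P = 12). -/
theorem tailT_rule : Scalars.tailT = ShearTailRule.tailTList Scalars.c Scalars.T 12 Scalars.Nm Scalars.eps := by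
  decide +kernel

/-- Hence both tail-lemma hypotheses hold for the rule's values at every certified mode. -/
theorem tails_rule_nonneg :
    (∀ x ∈ ShearTailRule.tailWList Scalars.c Scalars.T 12 Scalars.Nm Scalars.eps, 0 ≤ x) ∧
    (∀ x ∈ ShearTailRule.tailTList Scalars.c Scalars.T 12 Scalars.Nm Scalars.eps, 0 ≤ x) := by
  rw [← tailW_rule, ← tailT_rule]; exact ⟨Scalars.tailW_nonneg, Scalars.tailT_nonneg⟩

end Summit.NavierStokesRegularity.TurbBounds.Certs.C200
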